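import Summits.BirchSwinnertonDyer.BirchSwinnertonDyer.Theses.GenusKolyvaginAtTwo
import Summits.BirchSwinnertonDyer.BirchSwinnertonDyer.Theorems.GenusKolyvaginAtTwoLeafCensusShaCellSplit
import HarnessLib

/-!
# LINE 43 «twin_trivial_frame» — skeleton for the Ш-cell crux `RankOneShaCellBSDTwo` (stmt-BirchSwinnertonDyer-27477, route `GenusKolyvaginAtTwo`
# rev 72), FIVE stubs: WALL-BY-NAME · SUPPLY|tt (a TWIN-TRIVIAL odd Heegner frame) · UPPER|tt (the index annihilation at such a frame — decisive) ·
# LOWER|tt · PRINT×5.  v1.0, ideator bsd-idea-1 g31 (technique card «compactness–contradiction / rigidity»; director focus: beyond print at `2`).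

THE LEVER (new on this crux; five words: «twin-trivial Heegner frames, κ-match»).  Every Ш-cell line so far (LINE 23 §Ш / LEAD KEX⁰|Ш, LINE 41
«restriction_rigidity», LINE 42 «kolyvagin_structure») fixes the Heegner frame `K = ℚ(√d_K)` by Friedberg–Hoffstein ALONE and then fights the index
relation `#Ш(W_K)[2^∞]·4^t = 4^{M₀}` at an ARBITRARY frame, where BOTH factors of `Ш(W_K)[2^∞] ≅ Ш(W)[2^∞] ⊕ Ш(W^{(d_K)})[2^∞] ⊕ (Kramer glue 4^κ)`
carry test classes and the ℚ-side two-factor Kolyvagin count meets the ENTANGLED-BOTTOMS obstruction (LEAD R7 (3b), [D3]/p654425: a vanishing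
prescription on a `W^{(d)}`-type class sharing its mod-`2` bottom with a `W`-type class; the pair telescope's (IND) is then a genuine condition).
Here the frame is STEERED FIRST: by Mazur–Rubin rank-lowering twists run to the bottom (their Prop. 3.3 / Lemma 2.11 transversality at odd good
primes RAMIFIED in `K` — the transversality is IN THE TREE: `kummerLocalConditionAt_inf_unramifiedSubgroup_eq_bot_of_twist`,
`natCard_selmerGroup_twist_mul_two_eq_of_places`, gk2-p1/p5, crux 22136) one chooses `d_K` with enough ramified primes detecting `Sel₂(W)` that the
rank-zero twin is `2`-SELMER-TRIVIAL: `Sel₂(W^{(d_K)}) = 0`.  At such a TWIN-TRIVIAL frame: (i) `Sel₂(W) ∩ Sel₂(W^{(d_K)}) = 0` trivially — no shared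
bottoms, the pair telescope's (IND) is AUTOMATIC (the twin factor is `⊥`, LEAD R7-b's mechanism with the roles of the twins swapped); (ii) `Ш(W^{(d_K)})[2^∞] = 0`,
so the index relation reads `#Ш(W/ℚ)[2^∞] · 4^{κ+t} = 4^{M₀}` with `κ` the LOCAL Kramer glue at the ramified primes — ALL remaining content of the
Ш-cell at such a frame is the one named local–global statement «κ-MATCH» (LEAD R7 (3a), there avoided for U_T by cutting to `|d_K|` prime; on the
Ш-cell it cannot be avoided: B1, ideator g31 Barrier note — `Σ_{ℓ∣d_K} i_ℓ ≥ s ≥ 3` is forced by twin-triviality, so `κ ≥ 1`).  So LINE 43 converts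
«K-ANN on the Ш-cell» (LINE 41's K-ANN₁, LEAD's DIV|Ш) into: a CLOSABLE frame supply + ONE research statement whose mechanism is explicit (the
ℚ-side ONE-factor Kolyvagin telescope at `2` — CM cell T4 `card_mul_card_le_of_casselsTate_adaptive` shape with `Zm = ⊥` — plus strictness of the
ℚ-descended Kolyvagin classes at the ramified primes), and it identifies the Ш-cell's research content with U_T's uncut `DEF ≥ 3` locus (one frontier
statement instead of two).

WHY NOVEL vs the lines of record: LINE 41 restricts a fixed frame's classes to `K` (ISO₂ + one-bit slack + PAR); LINE 42 splits by Kolyvagin DEPTH;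
LINE 19/23 and gk2-p2's identity door make the RANK-ZERO member's twin `2`-Selmer MINIMAL on U₂ (`s = 1` side, ONE identity/transposition prime,
`κ = 0`); LINE 43 makes the RANK-ONE Ш-cell member's twin `2`-Selmer TRIVIAL (≥ `s` units of ramified transversality, `κ ≥ 1` accepted and named).
No listed line or route steers the Ш-cell frame.  bears_on: rung K4 `Rank1Residual.NonCMAtTwo` via GK2 crux 27477.

CHEAPEST FALSIFIER: a Ш-cell curve (15 with `Ш_an = 4` in the LINE 41 tables) admitting NO twin-trivial odd Heegner frame — instrument job
`kit:j343045` «l43-twintrivial» (PARI `ellrank` 2-descent of `W^{(D)}` on the 111 tabulated frames; analytic pre-count: 28 frames over all 15 curves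
have `v₂ #Ш_an(W^{(D)}) = 0`).  INSTRUMENT ROW THAT WOULD REFUTE THE KEY LEMMA (UPPER|tt): a twin-trivial frame with `2(M₀ − t − κ) < v₂ #Ш_an(W)` —
none in 111 frames (the law `2(M₀−t) = v₂#Ш_an(W) + v₂#Ш_an(W^D) + 2κ` is exact in 171/171 rows, LINE 41 v1.4).

BSD is NOT proved by this.  No summit / rung / crux / stub is proved by filing this; the `stub_*` are the obligations.
-/

set_option linter.dupNamespace false -- `Summit.<P>.<Sub>` repeats `BirchSwinnertonDyer` (D-0017)

noncomputable section

namespace Summit.BirchSwinnertonDyer.BirchSwinnertonDyer.Cruxes.RankOneShaCellBSDTwo.TwinTrivialFrame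

open scoped Classical NumberField

open Summit.BirchSwinnertonDyer.BirchSwinnertonDyer.Theses.GenusKolyvaginAtTwo
open WeierstrassCurve NumberField Literature.NumberTheory.EllipticCurves Literature.NumberTheory.EllipticCurves.ModularForms
  Literature.NumberTheory.EllipticCurves.Rank1Residual
  Literature.NumberTheory.EllipticCurves.Rank1Residual.Typed
  Summit.BirchSwinnertonDyer.Rank1Residual
  Summit.BirchSwinnertonDyer.BirchSwinnertonDyer.Rank1Residual
  Summit.BirchSwinnertonDyer.BirchSwinnertonDyer.Theorems.GenusExact.TwinSwap
  Summit.BirchSwinnertonDyer.BirchSwinnertonDyer.Theorems.GenusExact.TwinSwap.AnalyticTwin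
  Summit.BirchSwinnertonDyer.BirchSwinnertonDyer.Theorems.GenusExact.TwinSwap.AnalyticTwin.NoTwoTorsion
open Summit.BirchSwinnertonDyer.BirchSwinnertonDyer.Theorems
open Summit.BirchSwinnertonDyer.BirchSwinnertonDyer.Theorems.GenusExact.Census.TorsionCell (bsdp_rankZero_of_wallGK2)
open Summit.BirchSwinnertonDyer.BirchSwinnertonDyer.Theorems.GenusExact.TwinSwap.Ledger.Line25
  (exists_kolyvaginHeegnerData_one_of_nonempty_modularParametrizationData not_isOfFinAddOrder_derivedPoint_one_of_rankOne_of_lValue_ne_zero)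
open Summit.BirchSwinnertonDyer.BirchSwinnertonDyer.Theorems.KolyvaginAtTwo (exists_exactTwoDepth)

/-! ## Displayed Props -/

/-- SUPPLY|tt · A TWIN-TRIVIAL ODD HEEGNER FRAME for every Ш-cell curve (research-light, M/L; new object of the line): for `W` non-CM, `r_an(W) = 1`,
`W(ℚ)[2] = 0`, `#Sel₂(W) ≠ 2`, there is an imaginary quadratic `K` with `d_K` odd, `≠ −3`, Heegner for `N_W`, `2` split, `L(W^{(d_K)},1) ≠ 0`, such that
EVERY globally minimal model of the twin has TRIVIAL `2`-Selmer group: `#Sel₂(Wd) = 1`.  Road: Mazur–Rubin rank-lowering twists (Prop. 3.3 (i) at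
`T = {ℓ}`, `i_ℓ = 1`, transversality Lemma 2.11 = tree `kummerLocalConditionAt_inf_unramifiedSubgroup_eq_bot_of_twist`) by `≥ s` primes detecting
`Sel₂(W)`, Čebotarev-compatible with the Heegner and `2`-split congruences; then `L(W^{(d_K)},1) ≠ 0` from `Sel₂ = 0` by the rank-zero `2`-CONVERSE
(route `TwoAdicConverse` items 19218/19219 BY NAME on the good-ordinary / multiplicative-at-`2` locus — `d_K ≡ 1 (8)` makes `W^{(d_K)} ≅ W` over `ℚ₂`)
or by Friedberg–Hoffstein with local square classes.  WHY IT MIGHT FAIL: the simultaneous Čebotarev conditions may be dependent for some `W`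
(`ℚ(W[2]) ∩ ℚ(√p*, p ∣ 2N) ≠ ℚ`), and the nonvanishing step leans on the `2`-converse (beyond print off CM) unless FH-with-local-classes meets a
`Sel₂ = 0` twist.  Instrument: kit:j343045.  [cite: MazurRubin2010, Prop. 3.3, Lemma 2.11, Thm. 1.4] [cite: FriedbergHoffstein1995, Thm. B]
[cite: Kramer1981, Thm. 1] -/
def TwinTrivialFrameSupplyShaCellAtTwo : Prop :=
  ∀ (W : WeierstrassCurve ℚ) [W.IsElliptic] [W.IsGloballyMinimal] [NeZero (W.conductorNorm ℤ)],
    ¬ W.HasCM → W.analyticRank = 1 → (∀ P : W.toAffine.Point, 2 • P = 0 → P = 0) → Nat.card (W.selmerGroup 2) ≠ 2 →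
    ∃ (K : Type) (_ : Field K) (_ : NumberField K), IsImaginaryQuadratic K ∧ Odd (NumberField.discr K) ∧ NumberField.discr K ≠ -3 ∧
      SatisfiesHeegnerHypothesis (W.conductorNorm ℤ) K ∧ ((Ideal.span {(2 : ℤ)}).primesOver (𝓞 K)).ncard = 2 ∧
      (W.quadraticTwist (NumberField.discr K : ℚ)).entireLFunction 1 ≠ 0 ∧
      ∀ (Wd : WeierstrassCurve ℚ) [Wd.IsElliptic] [Wd.IsGloballyMinimal],
        (∃ C : VariableChange ℚ, C • W.quadraticTwist (NumberField.discr K : ℚ) = Wd) → Nat.card (Wd.selmerGroup 2) = 1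

/-- SUPPLY⁰|tt (v1.1 split, the ALGEBRAIC half of SUPPLY|tt; M/L, closable with in-tree technique): every Ш-cell curve has an odd Heegner frame
`K` (`d_K` odd, `≠ −3`, Heegner for `N_W`, `2` split) at which EVERY globally minimal model of the twin `W^{(d_K)}` has TRIVIAL `2`-Selmer group —
NO `L`-value clause.  Technique: iterate gk2-p2's one-prime engine behind the UNCONDITIONAL U₂ theorem
`exists_primeHeegner_selmerTrivial_minimalTwin_of_rank_one` (p782923) `s = dim Sel₂(W)` times — each steering prime `ℓ` with `dim W(ℚ_ℓ)[2] = 1` and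
non-zero localisation halves `#Sel₂` (tree `natCard_selmerGroup_twist_mul_two_eq_of_places`, Mazur–Rubin 2010 Prop. 3.3 / Cor. 3.4) — keeping the
product `d_K = ∏ ℓᵢ^*` negative, `≡ 1 (mod 8)` and Heegner.  B1 (barrier note): `≥ s − 𝟙[Δ_W > 0] ≥ 2` steering primes are NECESSARY (no prime frame).
WHY IT MIGHT FAIL: the Čebotarev conditions «`Frob_ℓ` of order 2 on `W[2]` and non-zero on the current Selmer classes» and the congruences on `ℓ mod 8N`
may be incompatible for special `W` (`ℚ(√Δ_W) ⊂ ℚ(W[2]) ∩ ℚ(ζ_{8N})`).  Instrument: kit:j343045 (48/111 sampled composite frames are twin-trivial).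
[cite: MazurRubin2010, Prop. 3.3, Cor. 3.4, Lemma 2.11] [cite: Kramer1981, Thm. 1] -/
def SelmerTrivialTwinSupplyShaCellAtTwo : Prop :=
  ∀ (W : WeierstrassCurve ℚ) [W.IsElliptic] [W.IsGloballyMinimal] [NeZero (W.conductorNorm ℤ)],
    ¬ W.HasCM → W.analyticRank = 1 → (∀ P : W.toAffine.Point, 2 • P = 0 → P = 0) → Nat.card (W.selmerGroup 2) ≠ 2 →
    ∃ (K : Type) (_ : Field K) (_ : NumberField K), IsImaginaryQuadratic K ∧ Odd (NumberField.discr K) ∧ NumberField.discr K ≠ -3 ∧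
      SatisfiesHeegnerHypothesis (W.conductorNorm ℤ) K ∧ ((Ideal.span {(2 : ℤ)}).primesOver (𝓞 K)).ncard = 2 ∧
      ∀ (Wd : WeierstrassCurve ℚ) [Wd.IsElliptic] [Wd.IsGloballyMinimal],
        (∃ C : VariableChange ℚ, C • W.quadraticTwist (NumberField.discr K : ℚ) = Wd) → Nat.card (Wd.selmerGroup 2) = 1

/-- CONV|tt (v1.1 split, the ANALYTIC half of SUPPLY|tt; research, a `2`-CONVERSE): at every odd Heegner frame of a Ш-cell curve whose twin is
`2`-Selmer-trivial, `L(W^{(d_K)},1) ≠ 0`.  Two roads, both inside route `TwoAdicConverse`'s programme: (a) the RANK-ZERO `2`-converse for the twin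
(`Sel₂(W^{(d)}) = 0 ⇒ Sel_{2^∞} = 0 ⇒ corank 0 ⇒ r_an(W^{(d)}) = 0`; items `GoodOrdinaryRankZeroTwoConverse` 19218 / `MultiplicativeRankZeroTwoConverse` 19219
BY NAME when `W` — hence `W^{(d)}`, as `d ≡ 1 (mod 8)` — is good-ordinary / multiplicative at `2`; no item covers supersingular or additive `W`);
(b) the RANK-ONE `2`-converse for `W` over `K` (`corank Sel_{2^∞}(W/K) = 1 + 0 = 1` is KNOWN here ⇒ `P_K` non-torsion ⇒ `L(W^{(d)},1) ≠ 0` by Gross–Zagier;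
`TwoAdicConverse` leaves `RankOneTwoConverse`, `MultTwoConverseOverKAtTwo`).  WHY IT MIGHT FAIL: both converses at `2` are beyond print off CM
(Skinner–Urban / W. Zhang / Burungale–Tian exclude `p = 2` or need CM); a Selmer-trivial twist with `L(W^{(d)},1) = 0` would contradict BSD, so the
statement is BSD-true — the risk is provability, not truth.  [cite: Skinner2020Converse, Thm. 1.1 (p odd)] [cite: WZhang2014, Thm. 1.1 (p ≥ 5)]
[cite: BurungaleTian2020pConverse, Thm. 1.1] -/
def TwinConverseShaCellAtTwo : Prop :=
  ∀ (W : WeierstrassCurve ℚ) [W.IsElliptic] [W.IsGloballyMinimal] [NeZero (W.conductorNorm ℤ)],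
    ¬ W.HasCM → W.analyticRank = 1 → (∀ P : W.toAffine.Point, 2 • P = 0 → P = 0) → Nat.card (W.selmerGroup 2) ≠ 2 →
    ∀ (K : Type) [Field K] [NumberField K], IsImaginaryQuadratic K →
      Odd (NumberField.discr K) → NumberField.discr K ≠ -3 → SatisfiesHeegnerHypothesis (W.conductorNorm ℤ) K →
      ((Ideal.span {(2 : ℤ)}).primesOver (𝓞 K)).ncard = 2 →
      (∀ (Wd : WeierstrassCurve ℚ) [Wd.IsElliptic] [Wd.IsGloballyMinimal],
        (∃ C : VariableChange ℚ, C • W.quadraticTwist (NumberField.discr K : ℚ) = Wd) → Nat.card (Wd.selmerGroup 2) = 1) →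
      (W.quadraticTwist (NumberField.discr K : ℚ)).entireLFunction 1 ≠ 0

/-- UPPER|tt · THE INDEX ANNIHILATION AT A TWIN-TRIVIAL FRAME (research XL — THE decisive stub; implied by BSD; beyond print at `2`): at a Ш-cell
frame as in SUPPLY|tt with `#Sel₂(Wd) = 1`, for every parametrisation datum and the exact `2`-depth `M₀` of `P(1)`:
`#Ш(W_K)[2^∞] · 4^t ∣ 4^{M₀}`, `t = ord₂ c + ord₂ C(W)`.  Since `Ш(W^{(d_K)})[2^∞] = 0` here, by restriction–corestriction (LINE 41 ISO₂) this is
`#Ш(W/ℚ)[2^∞] · 4^{κ+t} ∣ 4^{M₀}` with `κ` the Kramer glue at the primes of `d_K`: the ℚ-side ONE-FACTOR Kolyvagin telescope at `2` (the twin factor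
is `⊥`, so the pair telescope's independence condition is automatic — CM cell T4 shape `card_mul_card_le_of_casselsTate_adaptive` with `Zm = ⊥`)
PLUS «κ-MATCH»: the ℚ-descended Kolyvagin classes are STRICT (not merely relaxed) at the ramified primes, worth exactly the `κ` glue bits
(LEAD R7 (3a)).  WHY IT MIGHT FAIL: as a MECHANISM the one-factor telescope only gives `#Ш(W)[2^∞] ∣ 4^{M₀}` (slack `4^{κ+t}`, `κ ≥ 1` forced on the
Ш-cell) and κ-MATCH may be false class-by-class even though the divisibility itself follows from BSD; no Kolyvagin-system count at `2` over `ℚ` for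
non-CM curves is in print.  [cite: Kolyvagin1991MathAnn, Thm. 1] [cite: McCallumLMS1991, §5] [cite: MazurRubin2004KolyvaginSystems, Thm. 2.2.2]
[cite: Kramer1981, Thm. 1, Prop. 7] -/
def HeegnerIndexUpperTwinTrivialAtTwo : Prop :=
  ∀ (W : WeierstrassCurve ℚ) [W.IsElliptic] [W.IsGloballyMinimal] [NeZero (W.conductorNorm ℤ)],
    ¬ W.HasCM → W.analyticRank = 1 → (∀ P : W.toAffine.Point, 2 • P = 0 → P = 0) → Nat.card (W.selmerGroup 2) ≠ 2 →
    ∀ (K : Type) [Field K] [NumberField K], IsImaginaryQuadratic K →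
      Odd (NumberField.discr K) → NumberField.discr K ≠ -3 → SatisfiesHeegnerHypothesis (W.conductorNorm ℤ) K →
      ((Ideal.span {(2 : ℤ)}).primesOver (𝓞 K)).ncard = 2 →
      ∀ (Wd : WeierstrassCurve ℚ) [Wd.IsElliptic] [Wd.IsGloballyMinimal],
        (∃ C : VariableChange ℚ, C • W.quadraticTwist (NumberField.discr K : ℚ) = Wd) → Nat.card (Wd.selmerGroup 2) = 1 →
      (W.quadraticTwist (NumberField.discr K : ℚ)).entireLFunction 1 ≠ 0 →
      ∀ (Dt : ModularParametrizationData W (W.conductorNorm ℤ)) (β : ℤ) (ι : K →+* ℂ) (d₁ : KolyvaginHeegnerData Dt β ι 1) (M₀ : ℕ),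
        (∃ Q : (W.baseChange (ringClassField K ι 1)).toAffine.Point, ((2 ^ M₀ : ℕ) : ℤ) • Q = d₁.derivedPoint) →
        (¬ ∃ Q : (W.baseChange (ringClassField K ι 1)).toAffine.Point, ((2 ^ (M₀ + 1) : ℕ) : ℤ) • Q = d₁.derivedPoint) →
          Nat.card (AddCommGroup.primaryComponent (W.baseChange K).sha 2) * 2 ^ (2 * (padicValInt 2 Dt.c + padicValNat 2 W.tamagawaProduct)) ∣
            2 ^ (2 * M₀)

/-- LOWER|tt · the lower half at a twin-trivial frame (research L; the road is LINE 42's: on the `Δ < 0` habitat sub-cell it is the route's CLOSED L_T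
`powDvdShaCardAtTwoRT_proof` fed Q2 + one deep Kolyvagin witness (LINE 42 v1.2 `lower_onNegHabitat_of_deepWitness`); off it, Kolyvagin's structure
theorem at `2` with sharp defect `t`): `4^{M₀} ∣ #Ш(W_K)[2^∞] · 4^t`.  WHY IT MIGHT FAIL: the deep-witness supply at `2` (W. Zhang's `m_∞ = 0` at `p = 2`)
is open; a twin-trivial frame need not lie on the habitat.  [cite: WZhang2014, Thm. 1.1] [cite: Kolyvagin1991MathAnn, Thm. 1] -/
def HeegnerIndexLowerTwinTrivialAtTwo : Prop :=
  ∀ (W : WeierstrassCurve ℚ) [W.IsElliptic] [W.IsGloballyMinimal] [NeZero (W.conductorNorm ℤ)],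
    ¬ W.HasCM → W.analyticRank = 1 → (∀ P : W.toAffine.Point, 2 • P = 0 → P = 0) → Nat.card (W.selmerGroup 2) ≠ 2 →
    ∀ (K : Type) [Field K] [NumberField K], IsImaginaryQuadratic K →
      Odd (NumberField.discr K) → NumberField.discr K ≠ -3 → SatisfiesHeegnerHypothesis (W.conductorNorm ℤ) K →
      ((Ideal.span {(2 : ℤ)}).primesOver (𝓞 K)).ncard = 2 →
      ∀ (Wd : WeierstrassCurve ℚ) [Wd.IsElliptic] [Wd.IsGloballyMinimal],
        (∃ C : VariableChange ℚ, C • W.quadraticTwist (NumberField.discr K : ℚ) = Wd) → Nat.card (Wd.selmerGroup 2) = 1 →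
      (W.quadraticTwist (NumberField.discr K : ℚ)).entireLFunction 1 ≠ 0 →
      ∀ (Dt : ModularParametrizationData W (W.conductorNorm ℤ)) (β : ℤ) (ι : K →+* ℂ) (d₁ : KolyvaginHeegnerData Dt β ι 1) (M₀ : ℕ),
        (∃ Q : (W.baseChange (ringClassField K ι 1)).toAffine.Point, ((2 ^ M₀ : ℕ) : ℤ) • Q = d₁.derivedPoint) →
        (¬ ∃ Q : (W.baseChange (ringClassField K ι 1)).toAffine.Point, ((2 ^ (M₀ + 1) : ℕ) : ℤ) • Q = d₁.derivedPoint) →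
          2 ^ (2 * M₀) ∣
            Nat.card (AddCommGroup.primaryComponent (W.baseChange K).sha 2) * 2 ^ (2 * (padicValInt 2 Dt.c + padicValNat 2 W.tamagawaProduct))

/-! ## Stubs (the obligations; `sorry` ONLY here) -/

/-- stub WALL-BY-NAME = route items 19095–19098 (`ByReductionTypeAtTwo` rank-zero rows), the four WALL binders of `closes`. -/
theorem stub_wallByName :
    WallGoodOrdinaryRankZeroAtTwo ∧ WallMultiplicativeRankZeroAtTwo ∧ WallSupersingularRankZeroAtTwo ∧ WallAdditiveRankZeroAtTwo := by
  sorry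

/-- stub SUPPLY⁰|tt (v1.1; M/L, closable: Selmer-trivial composite odd Heegner twin, no `L`-clause). -/
theorem stub_selmerTrivialTwinSupply : SelmerTrivialTwinSupplyShaCellAtTwo := by
  sorry

/-- stub CONV|tt (v1.1; research: the `2`-converse at a Selmer-trivial twin frame; 19218/19219 by name on the ordinary/multiplicative-at-2 locus). -/
theorem stub_twinConverse : TwinConverseShaCellAtTwo := by
  sorry

/-- stub UPPER|tt (research XL; the decisive stub: one-factor ℚ-telescope at `2` + κ-MATCH). -/
theorem stub_heegnerIndexUpperTwinTrivial : HeegnerIndexUpperTwinTrivialAtTwo := by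
  sorry

/-- stub LOWER|tt (research L; LINE 42's road). -/
theorem stub_heegnerIndexLowerTwinTrivial : HeegnerIndexLowerTwinTrivialAtTwo := by
  sorry

/-- stub PRINT = the route's print items BY NAME — `GrossZagierAllLevels` (24148), `MultPublishedInputsAtTwo` (19921 = GZK), `EntireLFunctionRat`
(19273), `MilneAnyModel` (24149) — + BCDT `nonempty_modularParametrizationData`.  No Friedberg–Hoffstein: the frame comes from SUPPLY|tt. -/
theorem stub_printFacts :
    GrossZagierAllLevels ∧ MultPublishedInputsAtTwo ∧ EntireLFunctionRat ∧ MilneAnyModel ∧ nonempty_modularParametrizationData := by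
  sorry

/-! ## Closed pieces (kernel-checked, no sorry) -/

/-- v1.1 GLUE (kernel, no sorry): the algebraic supply and the twin converse give the v1.0 twin-trivial frame supply. [folklore] -/
theorem twinTrivialFrameSupply_of_selmerTrivial_of_converse (hS : SelmerTrivialTwinSupplyShaCellAtTwo) (hC : TwinConverseShaCellAtTwo) :
    TwinTrivialFrameSupplyShaCellAtTwo := by
  intro W _ _ _ hcm hr hT2 hSel
  obtain ⟨K, _, _, hK, hodd, h3, hH, h2, htt⟩ := hS W hcm hr hT2 hSel
  exact ⟨K, inferInstance, inferInstance, hK, hodd, h3, hH, h2, hC W hcm hr hT2 hSel K hK hodd h3 hH h2 (fun Wd _ _ hWd ↦ htt Wd hWd), htt⟩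

/-- **KEX at the supplied frame**: UPPER|tt + LOWER|tt give the exact index relation at a twin-trivial frame, at the exact `2`-depth of `P(1)`
(which exists: `P(1)` has infinite order by Gross–Zagier at an `L(W^{(d_K)},1) ≠ 0` frame).  CONDITIONAL. [cite: GrossZagier1986, V.§2 (2.2)] -/
theorem kex_at_twinTrivialFrame
    (hGZ : ∀ (N : ℕ) [NeZero N] (W : WeierstrassCurve ℚ) (K : Type) [Field K] [NumberField K], gross_zagier N W K)
    (hmod : hasEntireLFunction_rat)
    (hUp : HeegnerIndexUpperTwinTrivialAtTwo) (hLow : HeegnerIndexLowerTwinTrivialAtTwo)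
    (W : WeierstrassCurve ℚ) [W.IsElliptic] [W.IsGloballyMinimal] [NeZero (W.conductorNorm ℤ)] (hcm : ¬ W.HasCM)
    (hr : W.analyticRank = 1) (hT2 : ∀ P : W.toAffine.Point, 2 • P = 0 → P = 0) (hSel : Nat.card (W.selmerGroup 2) ≠ 2)
    (K : Type) [Field K] [NumberField K] (hK : IsImaginaryQuadratic K) (hodd : Odd (NumberField.discr K))
    (h3 : NumberField.discr K ≠ -3) (hH : SatisfiesHeegnerHypothesis (W.conductorNorm ℤ) K)
    (h2K : ((Ideal.span {(2 : ℤ)}).primesOver (𝓞 K)).ncard = 2)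
    (Wd : WeierstrassCurve ℚ) [Wd.IsElliptic] [Wd.IsGloballyMinimal]
    (hWd : ∃ C : VariableChange ℚ, C • W.quadraticTwist (NumberField.discr K : ℚ) = Wd) (htt : Nat.card (Wd.selmerGroup 2) = 1)
    (hLv : (W.quadraticTwist (NumberField.discr K : ℚ)).entireLFunction 1 ≠ 0)
    (Dt : ModularParametrizationData W (W.conductorNorm ℤ)) (β : ℤ) (ι : K →+* ℂ) (d₁ : KolyvaginHeegnerData Dt β ι 1) :
    ∃ M₀ : ℕ,
      (∃ Q : (W.baseChange (ringClassField K ι 1)).toAffine.Point, ((2 ^ M₀ : ℕ) : ℤ) • Q = d₁.derivedPoint) ∧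
      (¬ ∃ Q : (W.baseChange (ringClassField K ι 1)).toAffine.Point, ((2 ^ (M₀ + 1) : ℕ) : ℤ) • Q = d₁.derivedPoint) ∧
      Nat.card (AddCommGroup.primaryComponent (W.baseChange K).sha 2) *
          2 ^ (2 * (padicValInt 2 Dt.c + padicValNat 2 W.tamagawaProduct)) = 2 ^ (2 * M₀) := by
  have hy : ¬ IsOfFinAddOrder d₁.derivedPoint :=
    not_isOfFinAddOrder_derivedPoint_one_of_rankOne_of_lValue_ne_zero hmod W K (hGZ _ W K) hK hH hr hLv d₁
  haveI := (finiteDimensional_and_isGalois_ringClassField hK ι one_ne_zero).1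
  haveI : NumberField (ringClassField K ι 1) := NumberField.of_module_finite K _
  haveI : (W.baseChange (ringClassField K ι 1)).IsElliptic := by rw [baseChange]; infer_instance
  haveI : Module.Finite ℤ (W.baseChange (ringClassField K ι 1)).toAffine.Point := by
    convert (W.baseChange (ringClassField K ι 1)).module_finite_point_holds
  obtain ⟨M₀, hdiv, hndiv⟩ := exists_exactTwoDepth
    (A := (W.baseChange (ringClassField K ι 1)).toAffine.Point) (y := d₁.derivedPoint) (by convert hy)
  exact ⟨M₀, hdiv, hndiv, Nat.dvd_antisymm
    (hUp W hcm hr hT2 hSel K hK hodd h3 hH h2K Wd hWd htt hLv Dt β ι d₁ M₀ hdiv hndiv)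
    (hLow W hcm hr hT2 hSel K hK hodd h3 hH h2K Wd hWd htt hLv Dt β ι d₁ M₀ hdiv hndiv)⟩

/-- **COMPOSITION with displayed inputs** (kernel-checked): S1′ (from WALL) + SUPPLY|tt + UPPER|tt + LOWER|tt + PRINT×5 prove the Ш-cell text,
by LEAD g32's pointwise engine `swappedPairDescentAtTwo_shaDepth_noTwoTorsion_of_facts` at the SUPPLIED twin-trivial frame (proof body = p801119
`shaCell_of_wall_of_friedbergHoffstein_of_kex0Sha_of_facts` with Friedberg–Hoffstein replaced by SUPPLY|tt).  CONDITIONAL.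
[cite: GrossZagier1986, V.§2 (2.2)] [cite: Milne1972ArithmeticAV, §1 Thm. 1] -/
theorem shaCell_of_inputs
    (hGZ : ∀ (N : ℕ) [NeZero N] (W : WeierstrassCurve ℚ) (K : Type) [Field K] [NumberField K], gross_zagier N W K)
    (hGZK : rank_eq_analyticRank_of_analyticRank_le_one) (hmod : hasEntireLFunction_rat)
    (hMilneC : Milne1972.bsdQuotient_baseChange_quadratic_anyModel) (hMP : nonempty_modularParametrizationData)
    (hS1 : ∀ (W : WeierstrassCurve ℚ) [W.IsElliptic] [W.IsGloballyMinimal], ¬ W.HasCM → W.analyticRank = 0 → BSDp W 2)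
    (hSup : TwinTrivialFrameSupplyShaCellAtTwo) (hUp : HeegnerIndexUpperTwinTrivialAtTwo) (hLow : HeegnerIndexLowerTwinTrivialAtTwo) :
    ∀ (W : WeierstrassCurve ℚ) [W.IsElliptic] [W.IsGloballyMinimal], ¬ W.HasCM → W.analyticRank = 1 →
      (∀ P : W.toAffine.Point, 2 • P = 0 → P = 0) → Nat.card (W.selmerGroup 2) ≠ 2 → BSDp W 2 := by
  intro W _ _ hcm hr hT2 hSel
  haveI : NeZero (W.conductorNorm ℤ) := ⟨(W.conductorNorm_pos_holds).ne'⟩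
  -- the steered frame: odd Heegner, `2` split, `L(W^{(d_K)},1) ≠ 0`, twin `2`-Selmer trivial
  obtain ⟨K, _, _, hK, hodd, h3, hH, h2K, hL, htt⟩ := hSup W hcm hr hT2 hSel
  -- a globally minimal model of the twist
  have hD0 : (NumberField.discr K : ℚ) ≠ 0 := by exact_mod_cast NumberField.discr_ne_zero K
  haveI := W.isElliptic_quadraticTwist hD0
  obtain ⟨Cd, hmin⟩ := hasGlobalMinimalModel_rat_holds (W.quadraticTwist (NumberField.discr K : ℚ))
  haveI := hmin
  have htt' : Nat.card ((Cd • W.quadraticTwist (NumberField.discr K : ℚ)).selmerGroup 2) = 1 := htt _ ⟨Cd, rfl⟩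
  -- a conductor-1 datum and its Heegner point; KEX at this frame from UPPER|tt + LOWER|tt
  obtain ⟨Dt, β, ι, d₁, hc0⟩ := exists_kolyvaginHeegnerData_one_of_nonempty_modularParametrizationData hMP W K hK hH
  have hy : ¬ IsOfFinAddOrder d₁.derivedPoint :=
    not_isOfFinAddOrder_derivedPoint_one_of_rankOne_of_lValue_ne_zero hmod W K (hGZ _ W K) hK hH hr hL d₁
  obtain ⟨M₀, hdiv, hndiv, hsha⟩ := kex_at_twinTrivialFrame hGZ hmod hUp hLow W hcm hr hT2 hSel K hK hodd h3 hH h2K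
    (Cd • W.quadraticTwist (NumberField.discr K : ℚ)) ⟨Cd, rfl⟩ htt' hL Dt β ι d₁
  -- the twin is non-CM of analytic rank 0: `BSD₂(Wd)` from the wall
  have hcmd : ¬ (Cd • W.quadraticTwist (NumberField.discr K : ℚ)).HasCM := by
    rw [hasCM_iff_of_j_eq (((W.quadraticTwist (NumberField.discr K : ℚ)).variableChange_j Cd).trans (W.j_quadraticTwist hD0))]
    exact hcm
  have hrd : (Cd • W.quadraticTwist (NumberField.discr K : ℚ)).analyticRank = 0 := by
    rw [analyticRank_smul]
    exact ((W.quadraticTwist (NumberField.discr K : ℚ)).analyticRank_eq_zero_iff_holds (hmod _)).mpr hL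
  have hBd : BSDp (Cd • W.quadraticTwist (NumberField.discr K : ℚ)) 2 := hS1 _ hcmd hrd
  exact swappedPairDescentAtTwo_shaDepth_noTwoTorsion_of_facts hGZ hGZK hmod hMilneC W hr hT2 K hK hodd h3 hH Dt hc0 β ι d₁ hy M₀ hdiv hndiv
    hsha (Cd • W.quadraticTwist (NumberField.discr K : ℚ)) ⟨Cd, rfl⟩ hBd

/-- **THE LINE CONCLUDES THE CRUX BY NAME**: `RankOneShaCellBSDTwo` (stmt-BirchSwinnertonDyer-27477) from the SIX stubs (v1.1).  Sorry-free outside the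
stubs.  BSD is NOT proved by this. -/
theorem RankOneShaCellBSDTwo_of : Summit.BirchSwinnertonDyer.BirchSwinnertonDyer.Theses.GenusKolyvaginAtTwo.RankOneShaCellBSDTwo := by
  intro W _ _ hcm hr hT2 hSel
  exact shaCell_of_inputs stub_printFacts.1 stub_printFacts.2.1 stub_printFacts.2.2.1 stub_printFacts.2.2.2.1 stub_printFacts.2.2.2.2
    (fun W _ _ hcm0 hr0 ↦ bsdp_rankZero_of_wallGK2 stub_wallByName.1 stub_wallByName.2.1 stub_wallByName.2.2.1 stub_wallByName.2.2.2 W hcm0 hr0)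
    (twinTrivialFrameSupply_of_selmerTrivial_of_converse stub_selmerTrivialTwinSupply stub_twinConverse)
    stub_heegnerIndexUpperTwinTrivial stub_heegnerIndexLowerTwinTrivial W hcm hr hT2 hSel

end Summit.BirchSwinnertonDyer.BirchSwinnertonDyer.Cruxes.RankOneShaCellBSDTwo.TwinTrivialFrame
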